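import Summits.QuantumFields.BalabanUV.Beta.GAN24.ReadingWeightSums
import Summits.QuantumFields.BalabanUV.Beta.GAN24.AliasStripSymbols

/-!
# `BalabanUV.Beta.GAN24.ArrowInnerShiftScalars` — binder row G-an2-4 / (CONV-C), road P1-fibre, row **P1-L10-F4** (`ArrowInnerShift`) of the
# L10 owner's cut `HOME/b2b-balaban-gan24-formalise-leaf-16/L10-CUT-M4.md` («(M4) scaled alias-space Neumann, two anchors»), PART 1:
# the SCALAR LAYER of the INNER LIPSCHITZ bound — every alias symbol / border weight of the arrow operator moves by `O(|p|∞)` from its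
# value at the inner anchor `p = 0`, UNIFORMLY IN THE BLOCK SIDE `N`, at a COMPLEX coarse momentum `p` in the polydisc `‖p_i‖ ≤ ρ ≤ 1`

NOT IN PRINT; OUR PROOF ATTEMPT.  HONEST FRAMING (cell contract, verbatim): «discharging `BetaPertH` makes Bałaban's UV stability
UNCONDITIONAL — a real constructive-QFT result; it is NOT the continuum limit and NOT the Clay problem.»  HONEST DEPENDENCY (verbatim):
«continuum YM on T⁴ ⇐ BetaPertH ∧ nine spine estimates (0/9 proved); BetaPertH ⇐ (D1) ∧ (D4) ∧ CAP+tail; G-an2-4 gates asym, D1 and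
NE2/3/4.»  [folklore] bookkeeping estimates (elementary trigonometry of `e^{iw} − 1` at complex `w`); NO cited fact, NO `def … : Prop`
hypothesis, NO wall binder, NO new object (0 `def`).  NOT summit progress; nothing of (CONV-C)'s K-slot is discharged here.

## Why (row F4 of the cut; gan24-p1-g2's ratification CLAIMS l.3191 (1))
Row F4 is the inner Neumann step's Lipschitz input: `‖F̃_N(p) − F̃_N(0)‖ ≤ cIn(D)·|p|∞` for the SCALED arrow operator `F̃_N` on a complex
polydisc `|p|∞ ≤ ρ₁(D)`, uniformly in `N`.  By F1's structured bound (`sup_m ‖T̃_m‖ + ‖borU‖_F + ‖borV‖_F`) this reduces to ENTRY-LEVEL facts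
about the alias objects of `GAN24/AliasObjects` (`kAl`, `dAl`, `dbAl`, `LAl`, `gs`, `sAl`, `sbAl`, `SAl`, `SbAl`, `chiAl`; the arrow weights are
these by `AliasFibreBridge.sflat_eq_sbAl / boxS_eq_SAl / chiHat_eq_chiAl / boxSs_eq_SAl_mul_sAl`).  This file proves those facts; it is
INDEPENDENT of F1 (`ArrowOperator`, the operator currency) and of F2 (`AliasStripSymbols`): the inner region is a polydisc around `p = 0`,
so no strip hypothesis `|Re p_i| ≤ π` is needed, only `‖p_i‖ ≤ ρ ≤ 1`.  The operator-norm assembly (F1 currency) is PART 2 (`GAN24/ArrowInnerShift`).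

## What is proved (general `D`, `N ≥ 1`, `p : Fin D → ℂ` with `hp : ∀ i, ‖p i‖ ≤ ρ`, `0 ≤ ρ ≤ 1`; anchor `kAl N 0 m = (2π·val m)/N`, real)
* §1 anchor algebra: `kAl_eq_kAl_zero_add` (`kAl N p m i = kAl N 0 m i + p i/N`), `kAl_zero_eq_ofRealVec` (`kAl N 0 m = ofRealVec (kfine N 0 m)`),
  `norm_cexp_I_mul_kAl_zero` (`= 1`), `norm_cexp_neg_I_mul_sub_one_le` (`‖e^{−iw} − 1‖ ≤ 2‖w‖`, `‖w‖ ≤ 1`; the `+` form is F2's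
  `AliasStripSymbols.norm_cexp_I_mul_sub_one_le_two_mul`, Mathlib `Complex.norm_exp_sub_one_le`), `norm_div_natCast_le_div` (`‖p i/N‖ ≤ ρ/N ≤ ρ`).
* §2 BLOCKS, every alias `m`: `dAl_sub_dAl_zero` (`∂̂_m(p) − ∂̂_m(0) = e^{iθ}(e^{ip_κ/N} − 1)`), **`norm_dAl_sub_dAl_zero_le`** (`≤ 2ρ/N`) and the flat
  twin, `norm_dAl_zero_eq` (`‖∂̂_m(0)_κ‖ = 2|sin(kfine N 0 m κ/2)|`), `norm_dAl_le`, **`norm_LAl_sub_LAl_zero_le`**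
  (`‖L_m(p) − L_m(0)‖ ≤ (8ρ/N)·Σ_κ |sin(kfine N 0 m κ/2)| + 4Dρ²/N²`), the scaled form `sq_mul_norm_LAl_sub_LAl_zero_le`
  (`N²·‖ΔL_m‖ ≤ 8ρ·Σ_κ N|sin| + 4Dρ²`) and, for `m ≠ 0`, the RELATIVE form **`sq_mul_norm_LAl_sub_le_mul_lapR`**
  (`N²‖L_m(p) − L_m(0)‖ ≤ 3Dρ · N²·lapR (kfine N 0 m)`, via `AliasWeightsSum.four_le_sq_mul_lapR`: `4 ≤ N² lapR`).
* §3 THE ZERO ALIAS BLOCK (`T̃₀(0) = 0`): `kAl_origin` (`kAl N p 0 κ = p κ/N`), `norm_dAl_origin_le` (`‖∂̂_0(p)_κ‖ ≤ 2ρ/N`), flat twin,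
  `norm_LAl_origin_le` (`‖L_0(p)‖ ≤ 4Dρ²/N²`), scaled `mul_norm_dAl_origin_le` (`N‖∂̂_0‖ ≤ 2ρ`), `sq_mul_norm_LAl_origin_le` (`N²‖L_0‖ ≤ 4Dρ²`).
The zero-alias BORDER WEIGHTS (`s_κ(0)(p)`, `S(0)(p)`, `χ̂_0(p)` against their anchor values `N`, `N^D`, `1`) are PART 1b `GAN24/ArrowInnerShiftZeroBorder`;
the `m ≠ 0` border weights (which VANISH at the anchor; numerator form `‖s_i(m)(p)‖ ≤ 2ρ·N/(fold m_i − ρ)` on active coordinates) and the operator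
assembly are NOT in this part.  Constants are displayed and symbolic in `D` (TRIGGER-P1 c3); no float enters any statement.
Unit `b2b-balaban-gan24-formalise-leaf-04` (G-an2-4 formalisation swarm, gen 5), 2026-08-20.
-/

noncomputable section

open Complex Finset
open scoped BigOperators Real
open Literature.Probability.LatticeModels (TorusSite)
open Literature.MathematicalPhysics.QuantumFieldTheory
open Literature.MathematicalPhysics.QuantumFieldTheory.Balaban1983to89
open B4Strip (ofRealVec)
open Summit.QuantumFields.BalabanUV.Beta.GAN24.FibreSymbols (dhat dflat lapSym)
open Summit.QuantumFields.BalabanUV.Beta.GAN24.AliasWeights (kfine)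
open Summit.QuantumFields.BalabanUV.Beta.GAN24.AliasWeightsSum (lapR lapR_nonneg four_le_sq_mul_lapR sq_mul_lapR)
open Summit.QuantumFields.BalabanUV.Beta.GAN24.AliasObjects (kAl kAl_apply gs sAl SAl sbAl SbAl chiAl dAl dbAl LAl)
open Summit.QuantumFields.BalabanUV.Beta.GAN24.ReadingWeightSums (kAl_ofRealVec)
open Summit.QuantumFields.BalabanUV.Beta.GAN24.SymbolTaylor (ofRealVec_apply norm_dhat_ofRealVec)
open Summit.QuantumFields.BalabanUV.Beta.GAN24.AliasStripSymbols (norm_cexp_I_mul_sub_one_le_two_mul)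

namespace Summit.QuantumFields.BalabanUV.Beta.GAN24.ArrowInnerShiftScalars

variable {D : ℕ} {N : ℕ} [NeZero N]

/-! ## §1 Anchor algebra: `kAl N p m = kAl N 0 m + p/N`, the anchor is real, `‖e^{iw} − 1‖ ≤ 2‖w‖` -/

/-- [folklore] The fine momentum splits as the (real) anchor plus the scaled coarse momentum: `kAl N p m i = kAl N 0 m i + p i / N`. -/
theorem kAl_eq_kAl_zero_add (p : Fin D → ℂ) (m : TorusSite D N) (i : Fin D) :
    kAl N p m i = kAl N 0 m i + p i / (N : ℂ) := by
  rw [kAl_apply, kAl_apply, Pi.zero_apply, zero_add]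
  ring

/-- [folklore] The anchor is the real fine momentum of `AliasWeights`: `kAl N 0 m = ofRealVec (kfine N 0 m)`. -/
theorem kAl_zero_eq_ofRealVec (m : TorusSite D N) : kAl N (0 : Fin D → ℂ) m = ofRealVec (kfine N 0 m) := by
  have h0 : (0 : Fin D → ℂ) = ofRealVec (0 : Fin D → ℝ) := by
    funext i; rw [ofRealVec_apply]; simp
  funext i
  rw [h0, kAl_ofRealVec, ofRealVec_apply]

/-- [folklore] Coordinate form: `kAl N 0 m i = ↑(kfine N 0 m i)`. -/
theorem kAl_zero_apply (m : TorusSite D N) (i : Fin D) : kAl N (0 : Fin D → ℂ) m i = ((kfine N 0 m i : ℝ) : ℂ) := by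
  rw [kAl_zero_eq_ofRealVec, ofRealVec_apply]

/-- [folklore] The anchor phase is unimodular: `‖e^{i·kAl N 0 m i}‖ = 1`. -/
theorem norm_cexp_I_mul_kAl_zero (m : TorusSite D N) (i : Fin D) : ‖cexp (I * kAl N (0 : Fin D → ℂ) m i)‖ = 1 := by
  rw [kAl_zero_apply, mul_comm, Complex.norm_exp_ofReal_mul_I]

/-- [folklore] The flat anchor phase is unimodular: `‖e^{−i·kAl N 0 m i}‖ = 1`. -/
theorem norm_cexp_neg_I_mul_kAl_zero (m : TorusSite D N) (i : Fin D) : ‖cexp (-(I * kAl N (0 : Fin D → ℂ) m i))‖ = 1 := by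
  rw [kAl_zero_apply, show -(I * ((kfine N 0 m i : ℝ) : ℂ)) = ((-kfine N 0 m i : ℝ) : ℂ) * I by push_cast; ring,
    Complex.norm_exp_ofReal_mul_I]

/-- [folklore] `‖e^{−iw} − 1‖ ≤ 2‖w‖` for `‖w‖ ≤ 1`. -/
theorem norm_cexp_neg_I_mul_sub_one_le {w : ℂ} (hw : ‖w‖ ≤ 1) : ‖cexp (-(I * w)) - 1‖ ≤ 2 * ‖w‖ := by
  have h : ‖-(I * w)‖ ≤ 1 := by rwa [norm_neg, norm_mul, Complex.norm_I, one_mul]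
  have := Complex.norm_exp_sub_one_le h
  rwa [norm_neg, norm_mul, Complex.norm_I, one_mul] at this

omit [NeZero N] in
/-- [folklore] The scaled coarse momentum is small: `‖p i / N‖ ≤ ρ / N`. -/
theorem norm_div_natCast_le_div {p : Fin D → ℂ} {ρ : ℝ} (hp : ∀ i, ‖p i‖ ≤ ρ) (i : Fin D) :
    ‖p i / (N : ℂ)‖ ≤ ρ / N := by
  rw [norm_div, Complex.norm_natCast]
  exact div_le_div_of_nonneg_right (hp i) (Nat.cast_nonneg N)

/-- [folklore] `‖p i / N‖ ≤ ρ` (as `N ≥ 1`). -/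
theorem norm_div_natCast_le {p : Fin D → ℂ} {ρ : ℝ} (hp : ∀ i, ‖p i‖ ≤ ρ) (i : Fin D) : ‖p i / (N : ℂ)‖ ≤ ρ := by
  have hρ : 0 ≤ ρ := (norm_nonneg _).trans (hp i)
  have h1 : (1 : ℝ) ≤ (N : ℝ) := by exact_mod_cast Nat.one_le_iff_ne_zero.2 (NeZero.ne N)
  exact (norm_div_natCast_le_div hp i).trans (div_le_self hρ h1)

/-- [folklore] `‖p i / N‖ ≤ 1` when `ρ ≤ 1`. -/
theorem norm_div_natCast_le_one {p : Fin D → ℂ} {ρ : ℝ} (hp : ∀ i, ‖p i‖ ≤ ρ) (hρ1 : ρ ≤ 1) (i : Fin D) :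
    ‖p i / (N : ℂ)‖ ≤ 1 :=
  (norm_div_natCast_le hp i).trans hρ1

/-! ## §2 Blocks, every alias: the symbols `∂̂_m`, `∂̂♭_m`, `L_m` move by `O(ρ/N)`, `O(ρ·|sin|/N + ρ²/N²)` -/

/-- [folklore] `∂̂_m(p)_κ − ∂̂_m(0)_κ = e^{i kAl N 0 m κ} · (e^{i p_κ/N} − 1)`. -/
theorem dAl_sub_dAl_zero (p : Fin D → ℂ) (m : TorusSite D N) (κ : Fin D) :
    dAl N p m κ - dAl N 0 m κ = cexp (I * kAl N 0 m κ) * (cexp (I * (p κ / (N : ℂ))) - 1) := by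
  show dhat (kAl N p m) κ - dhat (kAl N 0 m) κ = _
  unfold FibreSymbols.dhat
  rw [kAl_eq_kAl_zero_add p m κ, mul_add, Complex.exp_add]
  ring

/-- [folklore] `∂̂♭_m(p)_κ − ∂̂♭_m(0)_κ = e^{−i kAl N 0 m κ} · (e^{−i p_κ/N} − 1)`. -/
theorem dbAl_sub_dbAl_zero (p : Fin D → ℂ) (m : TorusSite D N) (κ : Fin D) :
    dbAl N p m κ - dbAl N 0 m κ = cexp (-(I * kAl N 0 m κ)) * (cexp (-(I * (p κ / (N : ℂ)))) - 1) := by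
  show dflat (kAl N p m) κ - dflat (kAl N 0 m) κ = _
  unfold FibreSymbols.dflat
  rw [kAl_eq_kAl_zero_add p m κ, mul_add, neg_add, Complex.exp_add]
  ring

/-- [folklore] **FORWARD SYMBOL SHIFT**: `‖∂̂_m(p)_κ − ∂̂_m(0)_κ‖ ≤ 2ρ/N` for every alias `m`, `‖p_i‖ ≤ ρ ≤ 1`. -/
theorem norm_dAl_sub_dAl_zero_le {p : Fin D → ℂ} {ρ : ℝ} (hp : ∀ i, ‖p i‖ ≤ ρ) (hρ1 : ρ ≤ 1) (m : TorusSite D N) (κ : Fin D) :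
    ‖dAl N p m κ - dAl N 0 m κ‖ ≤ 2 * ρ / N := by
  rw [dAl_sub_dAl_zero, norm_mul, norm_cexp_I_mul_kAl_zero, one_mul]
  calc ‖cexp (I * (p κ / (N : ℂ))) - 1‖ ≤ 2 * ‖p κ / (N : ℂ)‖ := norm_cexp_I_mul_sub_one_le_two_mul (norm_div_natCast_le_one hp hρ1 κ)
    _ ≤ 2 * (ρ / N) := by have := norm_div_natCast_le_div (N := N) hp κ; linarith
    _ = 2 * ρ / N := by ring

/-- [folklore] **REFLECTED SYMBOL SHIFT**: `‖∂̂♭_m(p)_κ − ∂̂♭_m(0)_κ‖ ≤ 2ρ/N`. -/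
theorem norm_dbAl_sub_dbAl_zero_le {p : Fin D → ℂ} {ρ : ℝ} (hp : ∀ i, ‖p i‖ ≤ ρ) (hρ1 : ρ ≤ 1) (m : TorusSite D N) (κ : Fin D) :
    ‖dbAl N p m κ - dbAl N 0 m κ‖ ≤ 2 * ρ / N := by
  rw [dbAl_sub_dbAl_zero, norm_mul, norm_cexp_neg_I_mul_kAl_zero, one_mul]
  calc ‖cexp (-(I * (p κ / (N : ℂ)))) - 1‖ ≤ 2 * ‖p κ / (N : ℂ)‖ :=
        norm_cexp_neg_I_mul_sub_one_le (norm_div_natCast_le_one hp hρ1 κ)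
    _ ≤ 2 * (ρ / N) := by have := norm_div_natCast_le_div (N := N) hp κ; linarith
    _ = 2 * ρ / N := by ring

/-- [folklore] The anchor forward symbol has modulus `2|sin(kfine N 0 m κ / 2)|`. -/
theorem norm_dAl_zero_eq (m : TorusSite D N) (κ : Fin D) : ‖dAl N (0 : Fin D → ℂ) m κ‖ = 2 * |Real.sin (kfine N 0 m κ / 2)| := by
  show ‖dhat (kAl N 0 m) κ‖ = _
  rw [kAl_zero_eq_ofRealVec, norm_dhat_ofRealVec]

/-- [folklore] The anchor reflected symbol has the same modulus `2|sin(kfine N 0 m κ / 2)|`. -/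
theorem norm_dbAl_zero_eq (m : TorusSite D N) (κ : Fin D) : ‖dbAl N (0 : Fin D → ℂ) m κ‖ = 2 * |Real.sin (kfine N 0 m κ / 2)| := by
  show ‖dflat (kAl N 0 m) κ‖ = _
  unfold FibreSymbols.dflat
  rw [kAl_zero_apply, show -(I * ((kfine N 0 m κ : ℝ) : ℂ)) = I * ((-kfine N 0 m κ : ℝ) : ℂ) by push_cast; ring,
    Complex.norm_exp_I_mul_ofReal_sub_one, Real.norm_eq_abs, abs_mul, abs_two, neg_div, Real.sin_neg, abs_neg]

/-- [folklore] Anchor symbols are at most `2` in modulus. -/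
theorem norm_dAl_zero_le_two (m : TorusSite D N) (κ : Fin D) : ‖dAl N (0 : Fin D → ℂ) m κ‖ ≤ 2 := by
  rw [norm_dAl_zero_eq]
  have := Real.abs_sin_le_one (kfine N 0 m κ / 2)
  linarith

/-- [folklore] Anchor reflected symbols are at most `2` in modulus. -/
theorem norm_dbAl_zero_le_two (m : TorusSite D N) (κ : Fin D) : ‖dbAl N (0 : Fin D → ℂ) m κ‖ ≤ 2 := by
  rw [norm_dbAl_zero_eq]
  have := Real.abs_sin_le_one (kfine N 0 m κ / 2)
  linarith

/-- [folklore] `‖∂̂_m(p)_κ‖ ≤ 2|sin(kfine N 0 m κ/2)| + 2ρ/N`. -/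
theorem norm_dAl_le {p : Fin D → ℂ} {ρ : ℝ} (hp : ∀ i, ‖p i‖ ≤ ρ) (hρ1 : ρ ≤ 1) (m : TorusSite D N) (κ : Fin D) :
    ‖dAl N p m κ‖ ≤ 2 * |Real.sin (kfine N 0 m κ / 2)| + 2 * ρ / N := by
  have h := norm_dAl_sub_dAl_zero_le hp hρ1 m κ
  have e : dAl N p m κ = dAl N 0 m κ + (dAl N p m κ - dAl N 0 m κ) := by ring
  rw [e]
  exact (norm_add_le _ _).trans (by rw [norm_dAl_zero_eq]; linarith)

/-- [folklore] `‖∂̂♭_m(p)_κ‖ ≤ 2|sin(kfine N 0 m κ/2)| + 2ρ/N`. -/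
theorem norm_dbAl_le {p : Fin D → ℂ} {ρ : ℝ} (hp : ∀ i, ‖p i‖ ≤ ρ) (hρ1 : ρ ≤ 1) (m : TorusSite D N) (κ : Fin D) :
    ‖dbAl N p m κ‖ ≤ 2 * |Real.sin (kfine N 0 m κ / 2)| + 2 * ρ / N := by
  have h := norm_dbAl_sub_dbAl_zero_le hp hρ1 m κ
  have e : dbAl N p m κ = dbAl N 0 m κ + (dbAl N p m κ - dbAl N 0 m κ) := by ring
  rw [e]
  exact (norm_add_le _ _).trans (by rw [norm_dbAl_zero_eq]; linarith)

/-- [folklore] Three-term product rule: `‖ab − a₀b₀‖ ≤ ‖a − a₀‖·‖b₀‖ + ‖a₀‖·‖b − b₀‖ + ‖a − a₀‖·‖b − b₀‖`. -/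
theorem norm_mul_sub_mul_le_three (a a₀ b b₀ : ℂ) :
    ‖a * b - a₀ * b₀‖ ≤ ‖a - a₀‖ * ‖b₀‖ + ‖a₀‖ * ‖b - b₀‖ + ‖a - a₀‖ * ‖b - b₀‖ := by
  have e : a * b - a₀ * b₀ = (a - a₀) * b₀ + a₀ * (b - b₀) + (a - a₀) * (b - b₀) := by ring
  rw [e]
  refine (norm_add_le _ _).trans (add_le_add ((norm_add_le _ _).trans (add_le_add ?_ ?_)) ?_)
  · rw [norm_mul]
  · rw [norm_mul]
  · rw [norm_mul]

/-- [folklore] **LAPLACIAN SYMBOL SHIFT** (every alias): `‖L_m(p) − L_m(0)‖ ≤ (8ρ/N)·Σ_κ |sin(kfine N 0 m κ/2)| + 4Dρ²/N²`. -/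
theorem norm_LAl_sub_LAl_zero_le {p : Fin D → ℂ} {ρ : ℝ} (hp : ∀ i, ‖p i‖ ≤ ρ) (hρ1 : ρ ≤ 1) (m : TorusSite D N) :
    ‖LAl N p m - LAl N 0 m‖ ≤ 8 * ρ / N * ∑ κ, |Real.sin (kfine N 0 m κ / 2)| + 4 * D * ρ ^ 2 / (N : ℝ) ^ 2 := by
  have hsub : LAl N p m - LAl N 0 m = ∑ κ, (dAl N p m κ * dbAl N p m κ - dAl N 0 m κ * dbAl N 0 m κ) := by
    show lapSym (kAl N p m) - lapSym (kAl N 0 m) = _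
    unfold FibreSymbols.lapSym
    rw [← Finset.sum_sub_distrib]
  rw [hsub]
  have hterm : ∀ κ, ‖dAl N p m κ * dbAl N p m κ - dAl N 0 m κ * dbAl N 0 m κ‖
      ≤ 8 * ρ / N * |Real.sin (kfine N 0 m κ / 2)| + 4 * ρ ^ 2 / (N : ℝ) ^ 2 := by
    intro κ
    have h1 := norm_dAl_sub_dAl_zero_le hp hρ1 m κ
    have h2 := norm_dbAl_sub_dbAl_zero_le hp hρ1 m κ
    have h3 := norm_dAl_zero_eq (N := N) m κ
    have h4 := norm_dbAl_zero_eq (N := N) m κ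
    have hs : 0 ≤ |Real.sin (kfine N 0 m κ / 2)| := abs_nonneg _
    have hρN : 0 ≤ 2 * ρ / N := le_trans (norm_nonneg _) h1
    calc ‖dAl N p m κ * dbAl N p m κ - dAl N 0 m κ * dbAl N 0 m κ‖
        ≤ ‖dAl N p m κ - dAl N 0 m κ‖ * ‖dbAl N 0 m κ‖ + ‖dAl N 0 m κ‖ * ‖dbAl N p m κ - dbAl N 0 m κ‖
            + ‖dAl N p m κ - dAl N 0 m κ‖ * ‖dbAl N p m κ - dbAl N 0 m κ‖ := norm_mul_sub_mul_le_three _ _ _ _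
      _ ≤ (2 * ρ / N) * (2 * |Real.sin (kfine N 0 m κ / 2)|) + (2 * |Real.sin (kfine N 0 m κ / 2)|) * (2 * ρ / N)
            + (2 * ρ / N) * (2 * ρ / N) := by
          rw [h3, h4]
          exact add_le_add (add_le_add (mul_le_mul_of_nonneg_right h1 (by positivity))
            (mul_le_mul_of_nonneg_left h2 (by positivity))) (mul_le_mul h1 h2 (norm_nonneg _) hρN)
      _ = 8 * ρ / N * |Real.sin (kfine N 0 m κ / 2)| + 4 * ρ ^ 2 / (N : ℝ) ^ 2 := by ring
  calc ‖∑ κ, (dAl N p m κ * dbAl N p m κ - dAl N 0 m κ * dbAl N 0 m κ)‖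
      ≤ ∑ κ, ‖dAl N p m κ * dbAl N p m κ - dAl N 0 m κ * dbAl N 0 m κ‖ := norm_sum_le _ _
    _ ≤ ∑ κ, (8 * ρ / N * |Real.sin (kfine N 0 m κ / 2)| + 4 * ρ ^ 2 / (N : ℝ) ^ 2) := Finset.sum_le_sum fun κ _ => hterm κ
    _ = 8 * ρ / N * ∑ κ, |Real.sin (kfine N 0 m κ / 2)| + 4 * D * ρ ^ 2 / (N : ℝ) ^ 2 := by
        rw [Finset.sum_add_distrib, Finset.mul_sum, Finset.sum_const, Finset.card_univ, Fintype.card_fin, nsmul_eq_mul]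
        ring

/-- [folklore] SCALED FORM: `N²·‖L_m(p) − L_m(0)‖ ≤ 8ρ·Σ_κ N|sin(kfine N 0 m κ/2)| + 4Dρ²`. -/
theorem sq_mul_norm_LAl_sub_LAl_zero_le {p : Fin D → ℂ} {ρ : ℝ} (hp : ∀ i, ‖p i‖ ≤ ρ) (hρ1 : ρ ≤ 1) (m : TorusSite D N) :
    (N : ℝ) ^ 2 * ‖LAl N p m - LAl N 0 m‖ ≤ 8 * ρ * ∑ κ, (N : ℝ) * |Real.sin (kfine N 0 m κ / 2)| + 4 * D * ρ ^ 2 := by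
  have h := norm_LAl_sub_LAl_zero_le hp hρ1 m
  have hN : (0 : ℝ) < (N : ℝ) := by exact_mod_cast Nat.pos_of_ne_zero (NeZero.ne N)
  calc (N : ℝ) ^ 2 * ‖LAl N p m - LAl N 0 m‖
      ≤ (N : ℝ) ^ 2 * (8 * ρ / N * ∑ κ, |Real.sin (kfine N 0 m κ / 2)| + 4 * D * ρ ^ 2 / (N : ℝ) ^ 2) :=
        mul_le_mul_of_nonneg_left h (sq_nonneg _)
    _ = 8 * ρ * ∑ κ, (N : ℝ) * |Real.sin (kfine N 0 m κ / 2)| + 4 * D * ρ ^ 2 := by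
        rw [← Finset.mul_sum]
        field_simp

omit [NeZero N] in
/-- [folklore] Each scaled anchor sine is dominated by the scaled anchor Laplacian: `N|sin(kfine N 0 m κ/2)| ≤ √(N²·lapR)/2`, in the
squared form `4·(N|sin_κ|)² ≤ N²·lapR (kfine N 0 m)`. -/
theorem four_mul_sq_sin_le_sq_mul_lapR (m : TorusSite D N) (κ : Fin D) :
    4 * ((N : ℝ) * |Real.sin (kfine N 0 m κ / 2)|) ^ 2 ≤ (N : ℝ) ^ 2 * lapR (kfine N 0 m) := by
  rw [sq_mul_lapR]
  exact Finset.single_le_sum (f := fun j => 4 * ((N : ℝ) * |Real.sin (kfine N 0 m j / 2)|) ^ 2)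
    (fun j _ => by positivity) (Finset.mem_univ κ)

/-- [folklore] **RELATIVE LAPLACIAN SHIFT OFF THE ZERO ALIAS**: for `m ≠ 0` and `‖p_i‖ ≤ ρ ≤ 1`,
`N²·‖L_m(p) − L_m(0)‖ ≤ 3Dρ · N²·lapR (kfine N 0 m)` — i.e. `‖L_m(p) − L_m(0)‖ ≤ 3Dρ·L_m(0)` (as `N²L_m(0) ≥ 4`, `AliasWeightsSum.four_le_sq_mul_lapR`). -/
theorem sq_mul_norm_LAl_sub_le_mul_lapR {p : Fin D → ℂ} {ρ : ℝ} (hp : ∀ i, ‖p i‖ ≤ ρ) (hρ0 : 0 ≤ ρ) (hρ1 : ρ ≤ 1)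
    {m : TorusSite D N} (hm : m ≠ 0) :
    (N : ℝ) ^ 2 * ‖LAl N p m - LAl N 0 m‖ ≤ 3 * D * ρ * ((N : ℝ) ^ 2 * lapR (kfine N 0 m)) := by
  set ℓ := (N : ℝ) ^ 2 * lapR (kfine N 0 m) with hℓ
  have h4 : 4 ≤ ℓ := four_le_sq_mul_lapR (p := (0 : Fin D → ℝ)) (fun i => by simp [Real.pi_pos.le]) hm
  have h := sq_mul_norm_LAl_sub_LAl_zero_le hp hρ1 m
  -- each `N|sin_κ| ≤ ℓ/4 + 1 ≤ ℓ/2` would do; we use `2·N|sin_κ| ≤ (N|sin_κ|)² + 1 ≤ ℓ/4 + 1 ≤ ℓ/2`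
  have hsin : ∀ κ, (N : ℝ) * |Real.sin (kfine N 0 m κ / 2)| ≤ ℓ / 4 := by
    intro κ
    have hk := four_mul_sq_sin_le_sq_mul_lapR (N := N) m κ
    set s := (N : ℝ) * |Real.sin (kfine N 0 m κ / 2)| with hs
    have hs0 : 0 ≤ s := by positivity
    -- s ≤ s²/2 + 1/2 and 4s² ≤ ℓ, 4 ≤ ℓ
    nlinarith [sq_nonneg (s - 1)]
  have hsum : ∑ κ, (N : ℝ) * |Real.sin (kfine N 0 m κ / 2)| ≤ D * (ℓ / 4) := by
    calc ∑ κ, (N : ℝ) * |Real.sin (kfine N 0 m κ / 2)| ≤ ∑ _κ : Fin D, ℓ / 4 := Finset.sum_le_sum fun κ _ => hsin κ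
      _ = D * (ℓ / 4) := by rw [Finset.sum_const, Finset.card_univ, Fintype.card_fin, nsmul_eq_mul]
  have hD : (0 : ℝ) ≤ D := Nat.cast_nonneg D
  calc (N : ℝ) ^ 2 * ‖LAl N p m - LAl N 0 m‖
      ≤ 8 * ρ * ∑ κ, (N : ℝ) * |Real.sin (kfine N 0 m κ / 2)| + 4 * D * ρ ^ 2 := h
    _ ≤ 8 * ρ * (D * (ℓ / 4)) + 4 * D * ρ ^ 2 := by nlinarith
    _ ≤ 3 * D * ρ * ℓ := by nlinarith [mul_nonneg hD hρ0, mul_nonneg (mul_nonneg hD hρ0) hρ0]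

/-! ## §3 The zero-alias block: `∂̂_0(p) = e^{ip/N} − 1`, `L_0(p)` are `O(ρ/N)`, `O(ρ²/N²)` (and vanish at the anchor) -/

/-- [folklore] The zero alias has fine momentum `p/N`: `kAl N p 0 κ = p κ / N` (its anchor is `0`). -/
theorem kAl_origin (p : Fin D → ℂ) (κ : Fin D) : kAl N p (0 : TorusSite D N) κ = p κ / (N : ℂ) := by
  rw [kAl_apply]
  simp [Literature.MathematicalPhysics.QuantumFieldTheory.LatticeForm.repZ]

/-- [folklore] The zero-alias anchor symbols vanish: `∂̂_0(0)_κ = 0`. -/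
theorem dAl_origin_zero (κ : Fin D) : dAl N (0 : Fin D → ℂ) (0 : TorusSite D N) κ = 0 := by
  show dhat (kAl N 0 0) κ = 0
  unfold FibreSymbols.dhat
  rw [kAl_origin]; simp

/-- [folklore] `∂̂♭_0(0)_κ = 0`. -/
theorem dbAl_origin_zero (κ : Fin D) : dbAl N (0 : Fin D → ℂ) (0 : TorusSite D N) κ = 0 := by
  show dflat (kAl N 0 0) κ = 0
  unfold FibreSymbols.dflat
  rw [kAl_origin]; simp

/-- [folklore] `L_0(0) = 0`. -/
theorem LAl_origin_zero : LAl N (0 : Fin D → ℂ) (0 : TorusSite D N) = 0 := by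
  show lapSym (kAl N 0 0) = 0
  unfold FibreSymbols.lapSym
  exact Finset.sum_eq_zero fun κ _ => by
    rw [show dhat (kAl N 0 0) κ = dAl N (0 : Fin D → ℂ) (0 : TorusSite D N) κ from rfl, dAl_origin_zero, zero_mul]

/-- [folklore] **ZERO-ALIAS FORWARD SYMBOL**: `‖∂̂_0(p)_κ‖ ≤ 2ρ/N`. -/
theorem norm_dAl_origin_le {p : Fin D → ℂ} {ρ : ℝ} (hp : ∀ i, ‖p i‖ ≤ ρ) (hρ1 : ρ ≤ 1) (κ : Fin D) :
    ‖dAl N p (0 : TorusSite D N) κ‖ ≤ 2 * ρ / N := by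
  have h := norm_dAl_sub_dAl_zero_le hp hρ1 (0 : TorusSite D N) κ
  rwa [dAl_origin_zero, sub_zero] at h

/-- [folklore] `‖∂̂♭_0(p)_κ‖ ≤ 2ρ/N`. -/
theorem norm_dbAl_origin_le {p : Fin D → ℂ} {ρ : ℝ} (hp : ∀ i, ‖p i‖ ≤ ρ) (hρ1 : ρ ≤ 1) (κ : Fin D) :
    ‖dbAl N p (0 : TorusSite D N) κ‖ ≤ 2 * ρ / N := by
  have h := norm_dbAl_sub_dbAl_zero_le hp hρ1 (0 : TorusSite D N) κ
  rwa [dbAl_origin_zero, sub_zero] at h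

/-- [folklore] **ZERO-ALIAS LAPLACIAN SYMBOL**: `‖L_0(p)‖ ≤ 4Dρ²/N²`. -/
theorem norm_LAl_origin_le {p : Fin D → ℂ} {ρ : ℝ} (hp : ∀ i, ‖p i‖ ≤ ρ) (hρ1 : ρ ≤ 1) :
    ‖LAl N p (0 : TorusSite D N)‖ ≤ 4 * D * ρ ^ 2 / (N : ℝ) ^ 2 := by
  have h := norm_LAl_sub_LAl_zero_le hp hρ1 (0 : TorusSite D N)
  have hs : ∀ κ, |Real.sin (kfine N 0 (0 : TorusSite D N) κ / 2)| = 0 := fun κ => by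
    rw [ReadingWeightSums.kfine_zero]; simp
  simp only [hs, Finset.sum_const_zero, mul_zero, zero_add, LAl_origin_zero, sub_zero] at h
  exact h

/-- [folklore] SCALED: `N·‖∂̂_0(p)_κ‖ ≤ 2ρ`. -/
theorem mul_norm_dAl_origin_le {p : Fin D → ℂ} {ρ : ℝ} (hp : ∀ i, ‖p i‖ ≤ ρ) (hρ1 : ρ ≤ 1) (κ : Fin D) :
    (N : ℝ) * ‖dAl N p (0 : TorusSite D N) κ‖ ≤ 2 * ρ := by
  have h := norm_dAl_origin_le (N := N) hp hρ1 κ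
  have hN : (0 : ℝ) < (N : ℝ) := by exact_mod_cast Nat.pos_of_ne_zero (NeZero.ne N)
  calc (N : ℝ) * ‖dAl N p (0 : TorusSite D N) κ‖ ≤ (N : ℝ) * (2 * ρ / N) := mul_le_mul_of_nonneg_left h hN.le
    _ = 2 * ρ := by field_simp

/-- [folklore] SCALED: `N·‖∂̂♭_0(p)_κ‖ ≤ 2ρ`. -/
theorem mul_norm_dbAl_origin_le {p : Fin D → ℂ} {ρ : ℝ} (hp : ∀ i, ‖p i‖ ≤ ρ) (hρ1 : ρ ≤ 1) (κ : Fin D) :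
    (N : ℝ) * ‖dbAl N p (0 : TorusSite D N) κ‖ ≤ 2 * ρ := by
  have h := norm_dbAl_origin_le (N := N) hp hρ1 κ
  have hN : (0 : ℝ) < (N : ℝ) := by exact_mod_cast Nat.pos_of_ne_zero (NeZero.ne N)
  calc (N : ℝ) * ‖dbAl N p (0 : TorusSite D N) κ‖ ≤ (N : ℝ) * (2 * ρ / N) := mul_le_mul_of_nonneg_left h hN.le
    _ = 2 * ρ := by field_simp

/-- [folklore] SCALED: `N²·‖L_0(p)‖ ≤ 4Dρ²` (`≤ 4Dρ` for `ρ ≤ 1`). -/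
theorem sq_mul_norm_LAl_origin_le {p : Fin D → ℂ} {ρ : ℝ} (hp : ∀ i, ‖p i‖ ≤ ρ) (hρ1 : ρ ≤ 1) :
    (N : ℝ) ^ 2 * ‖LAl N p (0 : TorusSite D N)‖ ≤ 4 * D * ρ ^ 2 := by
  have h := norm_LAl_origin_le (N := N) hp hρ1
  have hN : (0 : ℝ) < (N : ℝ) := by exact_mod_cast Nat.pos_of_ne_zero (NeZero.ne N)
  calc (N : ℝ) ^ 2 * ‖LAl N p (0 : TorusSite D N)‖ ≤ (N : ℝ) ^ 2 * (4 * D * ρ ^ 2 / (N : ℝ) ^ 2) :=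
        mul_le_mul_of_nonneg_left h (sq_nonneg _)
    _ = 4 * D * ρ ^ 2 := by field_simp

end Summit.QuantumFields.BalabanUV.Beta.GAN24.ArrowInnerShiftScalars

end
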